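import Mathlib
-- import Summits.ValiantsHypothesis.ValiantsHypothesis.Theses.FeketeSOS  -- (route file; re-enable when the farm snapshot carries rev 7 — see SublinearShadowVerbatim)

/-!
# Sketch — crux-ideate stmt-ValiantsHypothesis-14990 (SublinearShadow), ideator 1, round 1

First lemmas of two idea cards:

* `WindowExtraction` (card frobenius-window-extraction): bilinear extraction of a sparse SOS identity
  through a linear functional on an `𝔽_p`-algebra window `R = O/pO`; cost = coefficient-span dimension.
* `cycAD`, `GramToSOS`, `IntegralGramExists`, `MinRankShadow` (card gram-hankel-min-rank): the
  union-support Gram/Hankel reformulation of the crux.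
-/

open Polynomial BigOperators

namespace Summit.ValiantsHypothesis.ValiantsHypothesis.Cruxes.SublinearShadow.Ideator1

/-! ## Card A: Frobenius-window extraction -/

/-- The `K`-span of the coefficients of a polynomial over a `K`-algebra `R` ("residual width"). -/
noncomputable def coeffSpan (K : Type) {R : Type} [Field K] [CommRing R] [Algebra K R]
    (G : Polynomial R) : Submodule K R :=
  Submodule.span K ((fun m => G.coeff m) '' (G.support : Set ℕ))

/-- WINDOW EXTRACTION (first lemma of card A, provable now).  Let `R` be a commutative `K`-algebra
(`char K ≠ 2`), `φ : R →ₗ[K] K` a functional, and suppose `Σ_i C_i · G_i² = u · f` in `R[X]` with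
`f ∈ K[X]` and `φ u = 1`.  Then `f` is a weighted sum of squares over `K`: for each `i` at most
`dim_K (coeffSpan G_i)` squares, each supported inside `supp G_i`.  (Proof: apply `φ` coefficientwise;
`(x,y) ↦ φ(C_i x y)` is a symmetric `K`-bilinear form on the finite-dimensional span of the coefficients
of `G_i`; take an orthogonal basis.)  Used with `R = O/pO ≅ k[t]/(t^e)` (an `𝔽_p`-algebra: no Witt
carries below `p`-adic depth `v(p)`), `u = t^v`, `φ =` coefficient of `t^v`. -/
def WindowExtraction : Prop :=
  ∀ (K : Type) [Field K] (R : Type) [CommRing R] [Algebra K R], (2 : K) ≠ 0 →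
    ∀ (φ : R →ₗ[K] K) (s : ℕ) (C : Fin s → R) (G : Fin s → Polynomial R) (f : Polynomial K) (u : R),
      φ u = 1 →
      (∑ i, Polynomial.C (C i) * G i ^ 2) = Polynomial.C u * f.map (algebraMap K R) →
      ∃ (d : Fin s → ℕ) (c' : (i : Fin s) → Fin (d i) → K) (g' : (i : Fin s) → Fin (d i) → Polynomial K),
        (∀ i, d i ≤ Module.finrank K (coeffSpan K (G i))) ∧
        (∀ i j, (g' i j).support ⊆ (G i).support) ∧
        (∑ i, ∑ j, Polynomial.C (c' i j) * g' i j ^ 2) = f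

/-- Sanity instance of the shape: with `R = K`, `φ = id`, `u = 1` the statement is the tautology
"an SOS identity over `K` is an SOS identity over `K`" (widths are ≤ 1). -/
example : Prop := WindowExtraction

/-! ## Card B: Gram / Hankel min-rank reformulation -/

/-- Cyclic anti-diagonal sum ("cyclic Hankel image") of a `Fin p × Fin p` matrix: the polynomial
`Σ_{m,m'} M_{m m'} X^{(m+m') mod p}` of degree `< p`; for a Gram matrix `M = Σ_j c_j h_j h_jᵀ` this is
`Σ_j c_j h_j(X)²` reduced modulo `X^p − 1`. -/
noncomputable def cycAD {p : ℕ} {R : Type} [CommRing R] (M : Matrix (Fin p) (Fin p) R) :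
    Polynomial R :=
  ∑ m : Fin p, ∑ m' : Fin p, Polynomial.C (M m m') * Polynomial.X ^ ((m + m' : Fin p) : ℕ)

/-- A matrix is supported on the pattern `T × T`. -/
def SupportedOn {p : ℕ} {R : Type} [Zero R] (T : Finset (Fin p)) (M : Matrix (Fin p) (Fin p) R) :
    Prop :=
  ∀ m m', M m m' ≠ 0 → m ∈ T ∧ m' ∈ T

/-- The reduced Fekete polynomial over a ring `R`. -/
noncomputable def fekete (R : Type) [CommRing R] (p : ℕ) [Fact p.Prime] : Polynomial R :=
  ∑ m ∈ Finset.range p, Polynomial.C ((legendreSym p m : ℤ) : R) * Polynomial.X ^ m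

/-- GRAM ⇒ SOS (provable now): a symmetric matrix of rank `r` on pattern `T × T` over a field of
characteristic `≠ 2` is a Gram matrix of `≤ r` weighted squares of `T`-supported vectors, hence its
cyclic Hankel image is a cyclic sum of `≤ r` squares of polynomials of degree `< p` with `≤ |T|`
monomials each. -/
def GramToSOS : Prop :=
  ∀ (K : Type) [Field K], (2 : K) ≠ 0 → ∀ (p : ℕ) (T : Finset (Fin p)) (M : Matrix (Fin p) (Fin p) K),
    M.IsSymm → SupportedOn T M →
    ∃ (d : ℕ) (c : Fin d → K) (g : Fin d → Polynomial K),
      d ≤ M.rank ∧ (∀ j, (g j).natDegree < p) ∧ (∀ j, (g j).support.card ≤ T.card) ∧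
      ((Polynomial.X : Polynomial K) ^ p - 1 ∣ (∑ j, Polynomial.C (c j) * g j ^ 2) - cycAD M)

/-- INTEGRAL GRAM MATRICES EXIST (provable now; the polar part cancels INSIDE the pattern): over a
valued field `(F, O)` with `2 ∈ O×`, every symmetric `T × T` matrix whose cyclic Hankel image has
`O`-integral coefficients differs from an `O`-INTEGRAL symmetric `T × T` matrix by an exactly
Hankel-null matrix (`cycAD N = 0`, an honest SOS identity `Σ c_j h_j² ≡ 0`).  Reason: the linear map
`cycAD : Sym_T(O) → O[X]_{<p}` is onto its rational image lattice (each anti-diagonal meets a pattern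
entry with coefficient 1 or 2). -/
def IntegralGramExists : Prop :=
  ∀ (F : Type) [Field F] (O : ValuationSubring F), IsUnit ((2 : ℕ) : O) →
    ∀ (p : ℕ) (T : Finset (Fin p)) (M : Matrix (Fin p) (Fin p) F),
      M.IsSymm → SupportedOn T M → (∀ n, (cycAD M).coeff n ∈ O) →
      ∃ M₁ : Matrix (Fin p) (Fin p) O,
        M₁.IsSymm ∧ SupportedOn T M₁ ∧ cycAD (M₁.map (algebraMap O F)) = cycAD M

/-- MIN-RANK SHADOW (the transfer `C⁺` of card B; it implies the crux by `GramToSOS` and folding of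
supports modulo `p`): if `F_p` has, over `ℂ`, a cyclic Gram matrix of rank `≤ s` on a pattern
`T × T` with `|T|⁴ ≤ p³`, then over some field of characteristic `p` the reduced `F̄_p` has a cyclic
Gram matrix of rank `≤ (s+1)^A` on the SAME pattern. -/
def MinRankShadow : Prop :=
  ∃ A p₁ : ℕ, ∀ (p : ℕ) [Fact p.Prime], p₁ ≤ p →
    ∀ (T : Finset (Fin p)) (s : ℕ) (M : Matrix (Fin p) (Fin p) ℂ),
      T.card ^ 4 ≤ p ^ 3 → M.IsSymm → SupportedOn T M → M.rank ≤ s → cycAD M = fekete ℂ p →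
      ∃ (K : Type) (_ : Field K) (_ : CharP K p) (M' : Matrix (Fin p) (Fin p) K),
        M'.IsSymm ∧ SupportedOn T M' ∧ M'.rank ≤ (s + 1) ^ A ∧ cycAD M' = fekete K p

/-- VERBATIM copy of the crux signature `FeketeSOS.SublinearShadow` (route file rev 7, item
stmt-ValiantsHypothesis-14990).  The farm snapshot used by `lean check` at 2026-08-16T08:xxZ predates
rev 7 of the route file (`FeketeSOSHard` resolves, `CharPSparseSOS`/`SublinearShadow` do not), so the
by-name reference is kept in the comment below and the composition is typed against this copy. -/
def SublinearShadowVerbatim : Prop :=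
  ∃ A p₁ : ℕ, ∀ (p : ℕ) [Fact p.Prime], p₁ ≤ p → ∀ (s : ℕ) (c : Fin s → ℂ) (g : Fin s → Polynomial ℂ), (∀ i, (g i).natDegree ≤ p ^ 2) → (∑ i, (g i).support.card) ^ 4 ≤ p ^ 3 → (∑ i, Polynomial.C (c i) * g i ^ 2) = ∑ m ∈ Finset.range p, Polynomial.C ((legendreSym p m : ℤ) : ℂ) * Polynomial.X ^ m → ∃ (K : Type) (_ : Field K) (_ : CharP K p) (d : ℕ) (c' : Fin d → K) (g' : Fin d → Polynomial K), d ≤ (s + 1) ^ A ∧ (∀ j, (g' j).natDegree < p) ∧ (∑ j, (g' j).support.card) ≤ (s + 1) ^ A * ∑ i, (g i).support.card ∧ ((Polynomial.X : Polynomial K) ^ p - 1 ∣ (∑ j, Polynomial.C (c' j) * g' j ^ 2) - ∑ m ∈ Finset.range p, Polynomial.C ((legendreSym p m : ℤ) : K) * Polynomial.X ^ m)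

/-- The intended composition (card B): `MinRankShadow ∧ GramToSOS ⇒ crux`.
By name: `MinRankShadow → GramToSOS → Summit.ValiantsHypothesis.ValiantsHypothesis.Theses.FeketeSOS.SublinearShadow`. -/
def Reduction : Prop :=
  MinRankShadow → GramToSOS → SublinearShadowVerbatim

/-- The intended composition (card A): window data at some place ⇒ crux; see card for `NarrowOrShallow`. -/
example : Prop := WindowExtraction → SublinearShadowVerbatim

end Summit.ValiantsHypothesis.ValiantsHypothesis.Cruxes.SublinearShadow.Ideator1
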